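import Mathlib
import HarnessLib
import Summits.NavierStokesRegularity.NavierStokesRegularity.Theorems.UnthreadedDoorAntidynamoWallOneInstantSymmetry
import Summits.NavierStokesRegularity.NavierStokesRegularity.Theorems.UnthreadedDoorAntidynamoWallOneInstantAxisymmetric

/-!
# Route `UnthreadedDoor` / `ThreadingFlux`, crux `PoloidalLiouville` (stmt-NavierStokesRegularity-1222), antidynamo v2 skeleton (sha16 `4ebf5683127b`),
# WALL `stub_scalarLiouville`: LOCAL one-instant symmetries — a rigid symmetry or an axisymmetry of the vorticity on ONE OPEN SET at ONE instant

Support file (seat leafhand-ns-unthreadeddoor-2 g2, cell decomp-ns), `--supports stmt-NavierStokesRegularity-1222 --as helper`; theorems only.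

In the analytic frame of the wall (`CellFlux.unthreadedAnalyticOrIrrotational`: a non-irrotational flow of the wall's class is jointly real-analytic) every
vorticity slice is real-analytic on the preconnected `ℝ³`, so a symmetry identity of the vorticity holding on a non-empty OPEN SET at one instant holds
everywhere at that instant (identity theorem).  Hence the one-instant theorems of `…WallOneInstantSymmetry` / `…WallOneInstantAxisymmetric` have LOCAL forms:

* ★★★ `curl_eq_zero_or_curl_symmetric_of_curl_symmetric_on_open` — vorticity `R`-symmetric (pseudovector) about some centre `x₁` ON ONE NON-EMPTY OPEN SET at
  ONE instant ⇒ `curl v ≡ 0`, or the vorticity is `R`-symmetric about `x₀` at EVERY instant; `curl_eq_zero_or_equivariant_of_curl_symmetric_on_open` — …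
  or the velocity is exactly `R`-equivariant about `x₀` at every time.
* ★★★ `curl_eq_zero_of_curl_axisymmetric_on_open` — the straightened vorticity `curl (conjAxis R x₁ (v t₁))` axisymmetric ON ONE NON-EMPTY OPEN SET (for all
  angles) at ONE instant ⇒ `curl v ≡ 0`.

MEANING FOR THE WALL: a non-trivial flow of the core has, at every instant and on every open set, a vorticity field with NO rigid symmetry about any centre
(other than those whose velocity is exactly equivariant about `x₀` at all times) and NO axisymmetry about any axis.

HONEST LABEL: identity theorem + landed one-instant theorems; nothing here proves `stub_scalarLiouville`, `PoloidalLiouville` (1222), or bears on Navier–Stokes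
regularity; no summit statement is proved. [folklore] [cite: KochNadirashviliSereginSverak2009, Thm 5.2 (arXiv:0709.3599 pp. 9–10); LemarieRieusset2016, Thm. 9.12]
-/

noncomputable section

-- the summit and its single sub-problem share the name (CONVENTIONS §1)
set_option linter.dupNamespace false

open scoped Topology InnerProductSpace RealInnerProductSpace ContDiff
open Filter Set Function Metric MeasureTheory
open Literature.Analysis Literature.Analysis.FluidPDE

namespace Summit.NavierStokesRegularity.NavierStokesRegularity.Theorems.PoloidalLiouville.Antidynamo

open Summit.NavierStokesRegularity.NavierStokesRegularity.Theorems.PoloidalLiouville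
  (toroidalPotential exists_norm_curl_le constantOfIrrotational)
open Summit.NavierStokesRegularity.NavierStokesRegularity.Theorems.PoloidalLiouville.NetFlux (E3)
open Summit.NavierStokesRegularity.NavierStokesRegularity.Theorems.PoloidalLiouville.CellFlux
  (conjAxis IsAxisymmetricNoSwirlAbout conjAxis_apply)

namespace OneInstant

/-! ### Analytic slices: local identities are global -/

/-- In an analytic frame every vorticity slice is real-analytic on `ℝ³`. [cite: LemarieRieusset2016, Thm. 9.12] -/
theorem analyticAt_curl_slice {v : ℝ → E3 → E3}
    (hA : AnalyticOnNhd ℝ (Function.uncurry v) (Iio (0 : ℝ) ×ˢ (univ : Set E3))) {t : ℝ} (ht : t < 0) (y : E3) :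
    AnalyticAt ℝ (fun z : E3 => curl (v t) z) y :=
  ((CellFlux.analyticOnNhd_curl_uncurry hA) (t, y) ⟨ht, mem_univ _⟩).comp₂ analyticAt_const analyticAt_id

/-- **A rigid symmetry of an analytic vorticity slice on a non-empty open set is a global one** (identity theorem on the preconnected `ℝ³`). [folklore] -/
theorem curl_symmetric_of_symmetric_on_open {v : ℝ → E3 → E3}
    (hA : AnalyticOnNhd ℝ (Function.uncurry v) (Iio (0 : ℝ) ×ˢ (univ : Set E3))) {t : ℝ} (ht : t < 0)
    (R : E3 ≃ₗᵢ[ℝ] E3) (x₁ : E3) {U : Set E3} (hUo : IsOpen U) (hUne : U.Nonempty)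
    (hU : ∀ y ∈ U, curl (v t) (x₁ + R y) = (R : E3 →L[ℝ] E3).det • R (curl (v t) (x₁ + y))) (y : E3) :
    curl (v t) (x₁ + R y) = (R : E3 →L[ℝ] E3).det • R (curl (v t) (x₁ + y)) := by
  obtain ⟨y₀, hy₀⟩ := hUne
  set f : E3 → E3 := fun y => curl (v t) (x₁ + R y) - (R : E3 →L[ℝ] E3).det • R (curl (v t) (x₁ + y)) with hf
  have hsl : ∀ z : E3, AnalyticAt ℝ (curl (v t)) z := fun z => analyticAt_curl_slice hA ht z
  have hRa : ∀ z : E3, AnalyticAt ℝ (⇑R) z := fun z => R.analyticAt z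
  have hfa : AnalyticOnNhd ℝ f univ := by
    intro y _
    simp only [hf]
    fun_prop
  have hev : f =ᶠ[𝓝 y₀] 0 := by
    filter_upwards [hUo.mem_nhds hy₀] with z hz
    simp only [hf, Pi.zero_apply, sub_eq_zero]
    exact hU z hz
  have h0 := hfa.eqOn_zero_of_preconnected_of_eventuallyEq_zero isPreconnected_univ (mem_univ y₀) hev (mem_univ y)
  simpa [hf, sub_eq_zero] using h0

/-! ### ★★★ Local rigid symmetry at one instant -/

/-- ★★★ **VORTICITY SYMMETRIC UNDER A RIGID MOTION ON ONE OPEN SET AT ONE INSTANT ⇒ IRROTATIONAL, OR SYMMETRIC ABOUT `x₀` AT EVERY INSTANT.**  Let `v` be a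
bounded ancient mild solution (`ν = 1`, duality class) with measurable slices, jointly smooth on `(−∞,0) × ℝ³`, with vorticity tangent to the spheres
about `x₀`.  If for ONE `t₁ < 0`, ONE linear isometry `R`, ONE centre `x₁` and ONE non-empty open set `U`,
`curl v(t₁)(x₁ + R y) = det R • R (curl v(t₁)(x₁ + y))` for all `y ∈ U`, then EITHER `curl v ≡ 0` OR
`curl v(t)(x₀ + R y) = det R • R (curl v(t)(x₀ + y))` for ALL `t < 0`, `y`.
[cite: KochNadirashviliSereginSverak2009, Thm 5.2 (arXiv:0709.3599 pp. 9–10); LemarieRieusset2016, Thm. 9.12] -/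
theorem curl_eq_zero_or_curl_symmetric_of_curl_symmetric_on_open
    (v : ℝ → EuclideanSpace ℝ (Fin 3) → EuclideanSpace ℝ (Fin 3)) (x₀ : EuclideanSpace ℝ (Fin 3))
    (hB : Literature.Analysis.FluidPDE.IsBoundedAncientMildSolution 1 v)
    (hm : ∀ t < 0, AEStronglyMeasurable (v t) volume)
    (hsm : ContDiffOn ℝ (⊤ : ℕ∞) (Function.uncurry v) (Set.Iio 0 ×ˢ Set.univ))
    (hun : ∀ t < 0, ∀ x, ⟪x - x₀, curl (v t) x⟫ = 0)
    (R : EuclideanSpace ℝ (Fin 3) ≃ₗᵢ[ℝ] EuclideanSpace ℝ (Fin 3)) (x₁ : EuclideanSpace ℝ (Fin 3)) {t₁ : ℝ} (ht₁ : t₁ < 0)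
    {U : Set (EuclideanSpace ℝ (Fin 3))} (hUo : IsOpen U) (hUne : U.Nonempty)
    (hU : ∀ y ∈ U, curl (v t₁) (x₁ + R y) =
      (R : EuclideanSpace ℝ (Fin 3) →L[ℝ] EuclideanSpace ℝ (Fin 3)).det • R (curl (v t₁) (x₁ + y))) :
    (∀ t < 0, ∀ x, curl (v t) x = 0) ∨
      ∀ t < 0, ∀ y, curl (v t) (x₀ + R y) =
        (R : EuclideanSpace ℝ (Fin 3) →L[ℝ] EuclideanSpace ℝ (Fin 3)).det • R (curl (v t) (x₀ + y)) := by
  obtain ⟨K, hK⟩ := exists_norm_curl_le hB hsm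
  obtain ⟨T, -, -, hlink⟩ := toroidalPotential v x₀ K hsm hK hun
  rcases CellFlux.unthreadedAnalyticOrIrrotational v x₀ T hB hm hsm hlink with hA | hZ
  · exact curl_eq_zero_or_curl_symmetric_of_curl_symmetric_slice v x₀ hB hm hsm hun R x₁ ht₁
      (curl_symmetric_of_symmetric_on_open hA ht₁ R x₁ hUo hUne hU)
  · exact Or.inl hZ

/-- ★★★ **… OR THE VELOCITY IS EXACTLY `R`-EQUIVARIANT ABOUT `x₀` AT EVERY TIME.** [cite: KochNadirashviliSereginSverak2009, Thm 5.2 (arXiv:0709.3599 pp. 9–10)] -/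
theorem curl_eq_zero_or_equivariant_of_curl_symmetric_on_open
    (v : ℝ → EuclideanSpace ℝ (Fin 3) → EuclideanSpace ℝ (Fin 3)) (x₀ : EuclideanSpace ℝ (Fin 3))
    (hB : Literature.Analysis.FluidPDE.IsBoundedAncientMildSolution 1 v)
    (hm : ∀ t < 0, AEStronglyMeasurable (v t) volume)
    (hsm : ContDiffOn ℝ (⊤ : ℕ∞) (Function.uncurry v) (Set.Iio 0 ×ˢ Set.univ))
    (hun : ∀ t < 0, ∀ x, ⟪x - x₀, curl (v t) x⟫ = 0)
    (R : EuclideanSpace ℝ (Fin 3) ≃ₗᵢ[ℝ] EuclideanSpace ℝ (Fin 3)) (x₁ : EuclideanSpace ℝ (Fin 3)) {t₁ : ℝ} (ht₁ : t₁ < 0)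
    {U : Set (EuclideanSpace ℝ (Fin 3))} (hUo : IsOpen U) (hUne : U.Nonempty)
    (hU : ∀ y ∈ U, curl (v t₁) (x₁ + R y) =
      (R : EuclideanSpace ℝ (Fin 3) →L[ℝ] EuclideanSpace ℝ (Fin 3)).det • R (curl (v t₁) (x₁ + y))) :
    (∀ t < 0, ∀ x, curl (v t) x = 0) ∨ ∀ t < 0, ∀ y, v t (x₀ + R y) = R (v t (x₀ + y)) := by
  rcases curl_eq_zero_or_curl_symmetric_of_curl_symmetric_on_open v x₀ hB hm hsm hun R x₁ ht₁ hUo hUne hU with h | h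
  · exact Or.inl h
  · exact curl_eq_zero_or_equivariant_of_curl_symmetric v x₀ hB hm hsm hun R h

/-! ### ★★★ Local axisymmetry of the vorticity at one instant -/

/-- **Local axisymmetry of an analytic straightened vorticity slice is global.** [folklore] -/
theorem isAxisymmetric_curl_conjAxis_of_on_open {v : ℝ → E3 → E3}
    (hA : AnalyticOnNhd ℝ (Function.uncurry v) (Iio (0 : ℝ) ×ˢ (univ : Set E3))) {t : ℝ} (ht : t < 0)
    (R : E3 ≃ₗᵢ[ℝ] E3) (x₁ : E3) {U : Set E3} (hUo : IsOpen U) (hUne : U.Nonempty)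
    (hU : ∀ θ : ℝ, ∀ y ∈ U, curl (conjAxis R x₁ (v t)) (rotZ θ y) = rotZ θ (curl (conjAxis R x₁ (v t)) y)) :
    IsAxisymmetric (curl (conjAxis R x₁ (v t))) := by
  obtain ⟨y₀, hy₀⟩ := hUne
  -- the straightened vorticity slice is analytic
  have hsl : ∀ z : E3, AnalyticAt ℝ (curl (v t)) z := fun z => analyticAt_curl_slice hA ht z
  have hRa : ∀ z : E3, AnalyticAt ℝ (⇑R) z := fun z => R.analyticAt z
  have hRs : ∀ z : E3, AnalyticAt ℝ (⇑R.symm) z := fun z => R.symm.analyticAt z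
  have hW : ∀ y : E3, AnalyticAt ℝ (curl (conjAxis R x₁ (v t))) y := by
    intro y
    have e : curl (conjAxis R x₁ (v t)) =
        fun z => (R : E3 →L[ℝ] E3).det • R (curl (v t) (R.symm z + x₁)) := funext fun z => CellFlux.curl_conjAxis R x₁ (v t) z
    rw [e]
    fun_prop
  intro θ y
  have hrot : ∀ z : E3, AnalyticAt ℝ (rotZ θ) z := fun z => (rotZLIE θ).analyticAt z
  set f : E3 → E3 := fun y => curl (conjAxis R x₁ (v t)) (rotZ θ y) - rotZ θ (curl (conjAxis R x₁ (v t)) y) with hf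
  have hfa : AnalyticOnNhd ℝ f univ := by
    intro z _
    simp only [hf]
    fun_prop
  have hev : f =ᶠ[𝓝 y₀] 0 := by
    filter_upwards [hUo.mem_nhds hy₀] with z hz
    simp only [hf, Pi.zero_apply, sub_eq_zero]
    exact hU θ z hz
  have h0 := hfa.eqOn_zero_of_preconnected_of_eventuallyEq_zero isPreconnected_univ (mem_univ y₀) hev (mem_univ y)
  simpa [hf, sub_eq_zero] using h0

/-- ★★★ **STRAIGHTENED VORTICITY AXISYMMETRIC ON ONE OPEN SET AT ONE INSTANT ⇒ IRROTATIONAL (swirl allowed, any axis).**  Under the hypotheses of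
`curl_eq_zero_of_curl_axisymmetric_slice`, it suffices that the axisymmetry identity `ω(R_θ y) = R_θ ω(y)` of the straightened vorticity
`ω = curl (conjAxis R x₁ (v t₁))` hold for all angles `θ` and all `y` in ONE non-empty open set.
[cite: KochNadirashviliSereginSverak2009, Thm 5.2 (arXiv:0709.3599 pp. 9–10); LemarieRieusset2016, Thm. 9.12] -/
theorem curl_eq_zero_of_curl_axisymmetric_on_open
    (v : ℝ → EuclideanSpace ℝ (Fin 3) → EuclideanSpace ℝ (Fin 3)) (x₀ : EuclideanSpace ℝ (Fin 3))
    (hB : Literature.Analysis.FluidPDE.IsBoundedAncientMildSolution 1 v)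
    (hm : ∀ t < 0, AEStronglyMeasurable (v t) volume)
    (hsm : ContDiffOn ℝ (⊤ : ℕ∞) (Function.uncurry v) (Set.Iio 0 ×ˢ Set.univ))
    (hun : ∀ t < 0, ∀ x, ⟪x - x₀, curl (v t) x⟫ = 0)
    (R : EuclideanSpace ℝ (Fin 3) ≃ₗᵢ[ℝ] EuclideanSpace ℝ (Fin 3)) (x₁ : EuclideanSpace ℝ (Fin 3)) {t₁ : ℝ} (ht₁ : t₁ < 0)
    {U : Set (EuclideanSpace ℝ (Fin 3))} (hUo : IsOpen U) (hUne : U.Nonempty)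
    (hU : ∀ θ : ℝ, ∀ y ∈ U, curl (conjAxis R x₁ (v t₁)) (rotZ θ y) = rotZ θ (curl (conjAxis R x₁ (v t₁)) y)) :
    ∀ t < 0, ∀ x, curl (v t) x = 0 := by
  obtain ⟨K, hK⟩ := exists_norm_curl_le hB hsm
  obtain ⟨T, -, -, hlink⟩ := toroidalPotential v x₀ K hsm hK hun
  rcases CellFlux.unthreadedAnalyticOrIrrotational v x₀ T hB hm hsm hlink with hA | hZ
  · exact curl_eq_zero_of_curl_axisymmetric_slice v x₀ hB hm hsm hun
      ⟨t₁, ht₁, R, x₁, isAxisymmetric_curl_conjAxis_of_on_open hA ht₁ R x₁ hUo hUne hU⟩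
  · exact hZ

/-- ★★★ **… HENCE SLICE-WISE CONSTANT.** [cite: KochNadirashviliSereginSverak2009, Thm 5.2 (arXiv:0709.3599 pp. 9–10)] -/
theorem constant_of_curl_axisymmetric_on_open
    (v : ℝ → EuclideanSpace ℝ (Fin 3) → EuclideanSpace ℝ (Fin 3)) (x₀ : EuclideanSpace ℝ (Fin 3))
    (hB : Literature.Analysis.FluidPDE.IsBoundedAncientMildSolution 1 v)
    (hm : ∀ t < 0, AEStronglyMeasurable (v t) volume)
    (hsm : ContDiffOn ℝ (⊤ : ℕ∞) (Function.uncurry v) (Set.Iio 0 ×ˢ Set.univ))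
    (hun : ∀ t < 0, ∀ x, ⟪x - x₀, curl (v t) x⟫ = 0)
    (R : EuclideanSpace ℝ (Fin 3) ≃ₗᵢ[ℝ] EuclideanSpace ℝ (Fin 3)) (x₁ : EuclideanSpace ℝ (Fin 3)) {t₁ : ℝ} (ht₁ : t₁ < 0)
    {U : Set (EuclideanSpace ℝ (Fin 3))} (hUo : IsOpen U) (hUne : U.Nonempty)
    (hU : ∀ θ : ℝ, ∀ y ∈ U, curl (conjAxis R x₁ (v t₁)) (rotZ θ y) = rotZ θ (curl (conjAxis R x₁ (v t₁)) y)) :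
    ∀ t < 0, ∃ b : EuclideanSpace ℝ (Fin 3), ∀ x, v t x = b :=
  constantOfIrrotational v hB hsm (curl_eq_zero_of_curl_axisymmetric_on_open v x₀ hB hm hsm hun R x₁ ht₁ hUo hUne hU)

end OneInstant

end Summit.NavierStokesRegularity.NavierStokesRegularity.Theorems.PoloidalLiouville.Antidynamo

end
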